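import Mathlib
import HarnessLib
import Literature.MathematicalPhysics.QuantumLattice.SectorisedKernelNormResectorisation
import Summits.HubbardSuperconductivity.HubbardSuperconductivity.Theorems.KLProgrammeKLRegimeEngineNormsStepRegime
import Summits.HubbardSuperconductivity.HubbardSuperconductivity.Theorems.KLProgrammeKLRegimeEngineE4ScaleDoor

/-!
# Route `KLProgramme` — crux K3 ENGINE, stub (b) `stub_engine_step_norms` (gen 7-flow: stub (b)-F): the LAG LEMMA PAIR — the public (E1-v4) and
# (E1-W) quantities of `𝒱_{k+1}` (thin family of index `k+1`) from the LAGGED, plateau-complete sizes of `𝒱_{k+1}` in the thin family of index `k`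

Cell gate-hubbard-kl, seat hubbard-kl-r2d-p2 (g4, E1 lead); plan g16 (R28′) «LAG: inline» (KL STATUS 2026-08-27T10:26:53Z): the inner induction of stub (b)-F
over internal levels carries the lagged invariant `P(j) := sizes of 𝒱_j in klAnisoFamily (j−1)` (plateau `{t ≤ Λ_j}` — k3c2-p3 SECTOR-RADIAL-ALIGNMENT §3, this
seat's plateau-lag finding); the PUBLIC conjuncts `KernelNormsV4 … j` / `KernelNormsWt … j` (family `j`, plateau only `{t ≤ Λ_{j+1}}`) are then exports, by
re-sectorisation across the plateau pair `(klAnisoFamily j, bgmFatMultiplier (j−1))` — no integration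
(`Literature.…SectorisedKernelNormResectorisation.hubbardSectorKernelNorm_le_of_plateau_pair` and its decay-weighted twin
`sum_wt_norm_sectorAnalysis_le_of_plateau_pair`).  Written with `j = k+1`:

* `klAnisoLegKernelNorm_le_of_lag` — UNWEIGHTED, overlap constants `(cr, cc)` as hypotheses:
  `klAnisoLegKernelNorm … K (k+1) (m+1) ≤ cr·cc^m·ε^m·(ε·‖𝒱_{k+1}‖_{klAnisoFamily k, univ, m+1})`;
* **`klAnisoLegKernelNorm_le_of_lag_klEng`** — the same under EXACTLY the binders of `stub_engine_step_norms` with p4's overlap constants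
  (`overlap_sums_klAniso_bgmFat_klEng`, ONE absolute `C_B`): `ε·klAnisoLegKernelNorm … (k+1) (m+1) ≤ (C_B/2)·C_B^m·(ε·‖𝒱_{k+1}‖_{klAnisoFamily k, univ, m+1})`
  for `k+1 ≤ nScales β + 1` — so `KernelNormsV4 … (k+1)` follows from the lagged sizes and the E1 fit;
* `sum_klScaleWt_norm_le_of_lag` / **`klWtPinnedSum_le_of_lag`** — WEIGHTED (tree weight `klScaleWt L M β nw` on `latticeLegPos (4M)`, weighted overlap
  constants as hypotheses): `klWtPinnedSum … K (k+1) (m+1) p w ≤ ε^m·cr·cc^m·(ε^{m+1}·B)` whenever the lagged weighted all-label pinned sums of degree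
  `m+1` (family `k`, weight `klScaleWt (k+1)`) are `≤ B` — so `KernelNormsWt N … (k+1)` follows for any budget above the right side.

RESIDUAL: the WEIGHTED overlap constants of the pair `(klAnisoFamily (k+1), bgmFatMultiplier k)` against `klScaleWt` (p4's …SectorMultiplierOverlap(Regime)
gives the unweighted ones) · p4 / k3c2-p3 layer B.  Everything is proved; no definitions; nothing about the model is asserted beyond these implications.
-/

noncomputable section

namespace Summit.HubbardSuperconductivity.HubbardSuperconductivity.Theorems.EngineV8

set_option linter.dupNamespace false -- summit = problem name (single-conjunct summit), D-0017

open Real Finset Literature.MathematicalPhysics.QuantumLattice Literature.Probability.LatticeModels GrassmannAlgebra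
open Literature.Probability.LatticeModels.BattleFederbush
open Summit.HubbardSuperconductivity.HubbardSuperconductivity.Theorems.KLProgrammeLegKernels
open Summit.HubbardSuperconductivity.HubbardSuperconductivity.Theorems.KLRegimeSplit
open Summit.HubbardSuperconductivity.HubbardSuperconductivity.Theorems.KLRegimeWick
open Summit.HubbardSuperconductivity.HubbardSuperconductivity.Theorems.TorusFourierL2

variable {L M : ℕ} [NeZero L] [NeZero M]

/-! ## §1 lag ⇒ (E1-v4)-shape -/

/-- **The public sectorised norm of `𝒱_{k+1}` from its lagged sizes** (re-sectorisation across the plateau pair `(klAnisoFamily (k+1), F̃_k)`):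
`klAnisoLegKernelNorm … K (k+1) (m+1) ≤ cr·cc^m·ε^m·(ε·‖𝒱_{k+1}‖_{klAnisoFamily k, univ, m+1})`, the overlap constants of `E(klAnisoFamily (k+1))·S(F̃_k)`
as hypotheses. -/
theorem klAnisoLegKernelNorm_le_of_lag {β : ℝ} (hβ : 0 < β) (U μ : ℝ) (K : TrigPolyC4v) (k : ℕ)
    {cr cc : ℝ} (hcr0 : 0 ≤ cr) (hcc0 : 0 ≤ cc)
    (hrow' : ∀ X'', ∑ X', ‖(sectorAnalysisMatrix L M β (klAnisoFamily L M β μ K klE0 (k + 1)) *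
      sectorSubMatrix L M β (bgmFatMultiplier L M klE0 β (nambuXiCT L μ K) k)) X'' X'‖ ≤ cr)
    (hcol' : ∀ X', ∑ X'', ‖(sectorAnalysisMatrix L M β (klAnisoFamily L M β μ K klE0 (k + 1)) *
      sectorSubMatrix L M β (bgmFatMultiplier L M klE0 β (nambuXiCT L μ K) k)) X'' X'‖ ≤ cc)
    (m : ℕ) :
    klAnisoLegKernelNorm L M β U μ K klE0 (k + 1) (m + 1) ≤
      cr * cc ^ m * imagTimeWeight β M ^ m *
        (imagTimeWeight β M * hubbardSectorKernelNorm L M β (klAnisoFamily L M β μ K klE0 k)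
          (univ : Finset (Fin (m + 1) → SectorLeg (sectorCount k))) (klEffectiveAction L M β U μ K klE0 (k + 1))) := by
  have he : (0 : ℝ) < klE0 := by norm_num [klE0]
  rw [klAnisoLegKernelNorm]
  exact hubbardSectorKernelNorm_le_of_plateau_pair hβ (klAnisoFamily L M β μ K klE0 k)
    (bgmFatMultiplier L M klE0 β (nambuXiCT L μ K) k) (fun ω p => bgmFatMultiplier_mul_bgmMultiplier he β (nambuXiCT L μ K) k ω p)
    (fun p hp ω => klAnisoFamily_eq_zero_of_sum_eq_zero β μ K klE0 k p hp ω) (klAnisoFamily L M β μ K klE0 (k + 1))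
    (fun ω' p h => sum_klAnisoFamily_eq_one_of_klAnisoFamily_ne_zero β μ K (le_refl (k + 1)) ω' p h)
    (klEffectiveAction L M β U μ K klE0 (k + 1)) hcr0 hcc0 hrow' hcol' m _

/-- **The same under the binders of `stub_engine_step_norms`, overlap constants DISCHARGED** (p4's `overlap_sums_klAniso_bgmFat_klEng`, one
absolute `C_B`; `ε·cr = C_B/2`, `ε·cc = C_B`): for `k + 1 ≤ nScales β + 1`,
`ε·klAnisoLegKernelNorm … K (k+1) (m+1) ≤ (C_B/2)·C_B^m·(ε·‖𝒱_{k+1}‖_{klAnisoFamily k, univ, m+1})`. -/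
theorem klAnisoLegKernelNorm_le_of_lag_klEng :
    ∃ CB : ℝ, 0 < CB ∧
      ∀ (P : SplitConsts) (R : RenConsts) (c : ℝ), P.WF → R.WF2 → 0 < c → c ≤ klEngC₃3 P R →
      ∀ μ ∈ klWindowC, ∀ U : ℝ, 0 < U → U ≤ klEngU₀4 P R c → ∀ β : ℝ, klBetaMin ≤ β → β ≤ Real.exp (c / U ^ 2) →
      ∀ K : TrigPolyC4v, FrameOK R U (nScales β) μ K → ∀ (L M : ℕ) [NeZero L] [NeZero M], klEngL₃ β U ≤ L → klEngM₃ β U L ≤ M →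
      ∀ k : ℕ, k + 1 ≤ nScales β + 1 → ∀ m : ℕ,
        imagTimeWeight β M * klAnisoLegKernelNorm L M β U μ K klE0 (k + 1) (m + 1) ≤
          CB / 2 * CB ^ m * (imagTimeWeight β M * hubbardSectorKernelNorm L M β (klAnisoFamily L M β μ K klE0 k)
            (univ : Finset (Fin (m + 1) → SectorLeg (sectorCount k))) (klEffectiveAction L M β U μ K klE0 (k + 1))) := by
  obtain ⟨CB, hCB, hO⟩ := overlap_sums_klAniso_bgmFat_klEng
  refine ⟨CB, hCB, ?_⟩
  intro P R c hP hR hc hc3 μ hμ U hU hUle β hβ hβc K hK L M _ _ hL hM k hk m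
  have hβpos : 0 < β := pos_of_klBetaMin_le hβ
  obtain ⟨hrow1, hcol1⟩ := hO P R c hP hR hc hc3 μ hμ U hU (le_klEngU₀3_of_le_klEngU₀4 hUle) β hβ hβc K hK L M hL hM (k + 1)
    (by omega) hk
  have h := klAnisoLegKernelNorm_le_of_lag hβpos U μ K k (by positivity : (0 : ℝ) ≤ CB * M / β) (by positivity : (0 : ℝ) ≤ 2 * CB * M / β)
    hrow1 hcol1 m
  have h' := mul_le_mul_of_nonneg_left h (imagTimeWeight_nonneg hβpos.le M)
  rwa [imagTimeWeight_mul_overlap_bound hβpos (M := M) CB _ m] at h'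

/-! ## §2 lag ⇒ (E1-W)-shape -/

/-- **The weighted all-label pinned sums of `𝒱_{k+1}` in the thin family of index `k+1` from its lagged weighted sizes** (decay-weighted
re-sectorisation across the plateau pair, tree weight `klScaleWt L M β nw` on `latticeLegPos (4M)`): with weighted overlap constants `(cr, cc)` of
`E(klAnisoFamily (k+1))·S(F̃_k)` and lagged weighted sizes `≤ B` in degree `m+1` (every pinned leg), one output leg pinned,
`Σ_{X_p = w} klScaleWt_{nw}(pos X)·‖kernel (map (toLin' E(klAnisoFamily (k+1))) 𝒱_{k+1}) (m+1) X‖ ≤ cr·cc^m·(ε^{m+1}·B)`. -/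
theorem sum_klScaleWt_norm_le_of_lag {β : ℝ} (hβ : 0 < β) (U μ : ℝ) (K : TrigPolyC4v) (k nw : ℕ)
    {cr cc : ℝ} (hcc0 : 0 ≤ cc)
    (hrow' : ∀ X'', ∑ X', ‖(sectorAnalysisMatrix L M β (klAnisoFamily L M β μ K klE0 (k + 1)) *
      sectorSubMatrix L M β (bgmFatMultiplier L M klE0 β (nambuXiCT L μ K) k)) X'' X'‖ *
        klScaleWt L M β nw {latticeLegPos (2 * (2 * M)) X'', latticeLegPos (2 * (2 * M)) X'} ≤ cr)
    (hcol' : ∀ X', ∑ X'', ‖(sectorAnalysisMatrix L M β (klAnisoFamily L M β μ K klE0 (k + 1)) *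
      sectorSubMatrix L M β (bgmFatMultiplier L M klE0 β (nambuXiCT L μ K) k)) X'' X'‖ *
        klScaleWt L M β nw {latticeLegPos (2 * (2 * M)) X'', latticeLegPos (2 * (2 * M)) X'} ≤ cc)
    {m : ℕ} {B : ℝ} (hB0 : 0 ≤ B)
    (hB : ∀ (q : Fin (m + 1)) (w : SpaceTimeIdx L M × SectorLeg (sectorCount k)),
      ∑ Y ∈ univ.filter (fun Y : Fin (m + 1) → SpaceTimeIdx L M × SectorLeg (sectorCount k) => Y q = w),
        klScaleWt L M β nw ((univ.image Y).image (latticeLegPos (2 * (2 * M)))) *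
          ‖kernel ℂ (ExteriorAlgebra.map (Matrix.toLin' (sectorAnalysisMatrix L M β (klAnisoFamily L M β μ K klE0 k)))
            (klEffectiveAction L M β U μ K klE0 (k + 1))) (m + 1) Y‖ ≤ B)
    (p : Fin (m + 1)) (w : SpaceTimeIdx L M × SectorLeg (sectorCount (k + 1))) :
    ∑ X ∈ univ.filter (fun X : Fin (m + 1) → SpaceTimeIdx L M × SectorLeg (sectorCount (k + 1)) => X p = w),
        klScaleWt L M β nw ((univ.image X).image (latticeLegPos (2 * (2 * M)))) *
          ‖kernel ℂ (ExteriorAlgebra.map (Matrix.toLin' (sectorAnalysisMatrix L M β (klAnisoFamily L M β μ K klE0 (k + 1))))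
            (klEffectiveAction L M β U μ K klE0 (k + 1))) (m + 1) X‖ ≤
      cr * cc ^ m * (imagTimeWeight β M ^ (m + 1) * B) := by
  have he : (0 : ℝ) < klE0 := by norm_num [klE0]
  exact sum_wt_norm_sectorAnalysis_le_of_plateau_pair (isTreeWeight_klScaleWt L M hβ.le nw) (latticeLegPos (2 * (2 * M)))
    (latticeLegPos (2 * (2 * M))) hβ (klAnisoFamily L M β μ K klE0 k) (bgmFatMultiplier L M klE0 β (nambuXiCT L μ K) k)
    (fun ω q => bgmFatMultiplier_mul_bgmMultiplier he β (nambuXiCT L μ K) k ω q)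
    (fun q hq ω => klAnisoFamily_eq_zero_of_sum_eq_zero β μ K klE0 k q hq ω) (klAnisoFamily L M β μ K klE0 (k + 1))
    (fun ω' q h => sum_klAnisoFamily_eq_one_of_klAnisoFamily_ne_zero β μ K (le_refl (k + 1)) ω' q h)
    (klEffectiveAction L M β U μ K klE0 (k + 1)) hcc0 hrow' hcol' hB0 hB p w

/-- **`klWtPinnedSum_le_of_lag` — the (E1-W) quantity of `𝒱_{k+1}` (its own family and weight, k3c3-p2's `klWtPinnedSum`) from the lagged weighted
sizes**: `klWtPinnedSum … K (k+1) (m+1) p w ≤ ε^m·(cr·cc^m·(ε^{m+1}·B))` (weight scale `nw = k+1`; weighted overlap constants as hypotheses). -/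
theorem klWtPinnedSum_le_of_lag {β : ℝ} (hβ : 0 < β) (U μ : ℝ) (K : TrigPolyC4v) (k : ℕ)
    {cr cc : ℝ} (hcc0 : 0 ≤ cc)
    (hrow' : ∀ X'', ∑ X', ‖(sectorAnalysisMatrix L M β (klAnisoFamily L M β μ K klE0 (k + 1)) *
      sectorSubMatrix L M β (bgmFatMultiplier L M klE0 β (nambuXiCT L μ K) k)) X'' X'‖ *
        klScaleWt L M β (k + 1) {latticeLegPos (2 * (2 * M)) X'', latticeLegPos (2 * (2 * M)) X'} ≤ cr)
    (hcol' : ∀ X', ∑ X'', ‖(sectorAnalysisMatrix L M β (klAnisoFamily L M β μ K klE0 (k + 1)) *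
      sectorSubMatrix L M β (bgmFatMultiplier L M klE0 β (nambuXiCT L μ K) k)) X'' X'‖ *
        klScaleWt L M β (k + 1) {latticeLegPos (2 * (2 * M)) X'', latticeLegPos (2 * (2 * M)) X'} ≤ cc)
    {m : ℕ} {B : ℝ} (hB0 : 0 ≤ B)
    (hB : ∀ (q : Fin (m + 1)) (w : SpaceTimeIdx L M × SectorLeg (sectorCount k)),
      ∑ Y ∈ univ.filter (fun Y : Fin (m + 1) → SpaceTimeIdx L M × SectorLeg (sectorCount k) => Y q = w),
        klScaleWt L M β (k + 1) ((univ.image Y).image (latticeLegPos (2 * (2 * M)))) *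
          ‖kernel ℂ (ExteriorAlgebra.map (Matrix.toLin' (sectorAnalysisMatrix L M β (klAnisoFamily L M β μ K klE0 k)))
            (klEffectiveAction L M β U μ K klE0 (k + 1))) (m + 1) Y‖ ≤ B)
    (p : Fin (m + 1)) (w : SpaceTimeIdx L M × SectorLeg (sectorCount (k + 1))) :
    klWtPinnedSum L M β U μ K (k + 1) (m + 1) p w ≤ imagTimeWeight β M ^ m * (cr * cc ^ m * (imagTimeWeight β M ^ (m + 1) * B)) := by
  rw [klWtPinnedSum_def, Nat.add_sub_cancel]
  exact mul_le_mul_of_nonneg_left (sum_klScaleWt_norm_le_of_lag hβ U μ K k (k + 1) hcc0 hrow' hcol' hB0 hB p w)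
    (pow_nonneg (imagTimeWeight_nonneg hβ.le M) m)

end Summit.HubbardSuperconductivity.HubbardSuperconductivity.Theorems.EngineV8

end
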